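import Summits.BirchSwinnertonDyer.BirchSwinnertonDyer.Theorems.TeichmullerTwistDescentWeightExclusionTypeIV
import Literature.NumberTheory.GaloisRepresentations.SerreWeightLevelOneGeneralEvaluationProofs
import HarnessLib

/-!
# Route `TeichmullerTwistDescent`, crux K `TwistedPeriodLatticeSaturation` (stmt-BirchSwinnertonDyer-25368):
# the weight exclusion (W‴) off Kodaira type III from THREE published facts — the Serre-recipe hypotheses discharged

Cell `pub/bsd-wall` (D-0145 line route-BirchSwinnertonDyer-TeichmullerTwistDescent, OPEN rev 7), seat `bsd-line-ttd-p1` (prover 1/2,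
g27).  THEOREMS ONLY; `--supports stmt-BirchSwinnertonDyer-25368`.  BSD is not proved by this file; K is NOT proved by this file;
nothing here closes an item.  Sequel of `TeichmullerTwistDescentWeightExclusionTypeII` / `…TypeIV`.

WHAT.  The same three conclusions — (W‴) `NoEtaleWeightEigenQuotient` on `ord_pΔ_min = 2`, on `ord_pΔ_min = 4`, and on
`ord_pΔ_min ≠ 3` — from ONLY the three cite-only published facts (WEIGHT) `fullLevelHomology_twist_isModular_of_eigenMap`
(Buzzard–Diamond–Jarvis 2010 §2), (SHAPE) `Kraus1997.propOne_inertiaShape_of_ordinary` (Kraus 1997 Prop. 1) and (MIN)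
`edixhoven1992_serreWeight_le_weight_of_newform` (Edixhoven 1992 Thm. 4.5): the two Serre-recipe hypotheses of the earlier files
(`IsSerreWeight.unique`, `isSerreWeight_serreWeightLocal`) are DISCHARGED by the unconditional evaluation
`serreWeight_eq_of_hasLevelOneInertiaShape_generic` (`SerreWeightLevelOneGeneralEvaluationProofs`: in the range `1 ≤ α, β ≤ p − 2`,
`|α − β| ≠ 1` every normalisation of Serre's recipe gives `1 + p·min + max`, and the level-two case is excluded).  All four
normalised shapes met here — `(1, 2b)`, `(3b + 1, 5b)` (type II), `(1, 2b)`, `(3h + 1, h)` (type IV, `b = 2h`) — lie in that range.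

Consequently the K-line now reads: K ⟸ `exists_isNewformOf` ∧ TYPE_central ∧ (W‴), and (W‴) ⟸ WEIGHT ∧ SHAPE ∧ MIN off type III;
on type III (`e = 4`) the sign `s ≡ b` of the twist exponent is still needed.
-/

set_option autoImplicit false
-- single-conjunct summit: `Summit.BirchSwinnertonDyer.BirchSwinnertonDyer.…` repeats the name by design
set_option linter.dupNamespace false

noncomputable section

open scoped MatrixGroups NumberField Valued
open Function CongruenceSubgroup IsDedekindDomain ValuativeRel
open Literature.RepresentationTheory.FiniteGroups Literature.RepresentationTheory.FiniteGroups.GL2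
  Literature.NumberTheory.EllipticCurves.ModularForms
open Literature.NumberTheory.EllipticCurves (Kato2004.teichmullerChar)
open Literature.NumberTheory.ModularSymbols Literature.NumberTheory.ModularSymbols.FullLevel
open Literature.NumberTheory.GaloisRepresentations Literature.NumberTheory.GaloisRepresentations.ModPGaloisRep
open Literature.NumberTheory.GaloisRepresentations.IsNonarchimedeanLocalField
open Literature.NumberTheory.Automorphic

namespace Summit.BirchSwinnertonDyer.BirchSwinnertonDyer.Theorems.TeichmullerTwistDescent

open WeierstrassCurve Literature.NumberTheory.EllipticCurves Literature.NumberTheory.EllipticCurves.Rank1Residual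
open Summit.BirchSwinnertonDyer.BirchSwinnertonDyer.Theses.TeichmullerTwistDescent

namespace WeightExclusion

/-! ### The contradiction from a generic normalised shape, without recipe hypotheses -/

/-- **Generic step, recipe hypotheses discharged.**  As `false_of_twist_isModular_of_shape`, but WITHOUT `IsSerreWeight.unique` and
`isSerreWeight_serreWeightLocal`: if the shape `(a + s, a' + s)` of the twist `ω^s ρ̄ ⊗ k` is congruent mod `p − 1` to `(β, α)` with
`1 ≤ α, β ≤ p − 2` and `|α − β| ≠ 1`, then `k(ω^s ρ̄) = 1 + p·min(α, β) + max(α, β) ≥ p + 1`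
(`serreWeight_eq_of_hasLevelOneInertiaShape_generic`) contradicts Edixhoven's `k(ω^s ρ̄) ≤ w ≤ p`.
[cite: Edixhoven1992, Thm. 4.5] [cite: Serre1987, §2.2–2.4] -/
theorem false_of_twist_isModular_of_generic_shape {p : ℕ} [Fact p.Prime] {k : Type} [Field k] [TopologicalSpace k]
    [DiscreteTopology k] [CharP k p] [IsAlgClosed k] (hp2 : p ≠ 2)
    (hEd : edixhoven1992_serreWeight_le_weight_of_newform)
    {ρ : ModPGaloisRep ℚ (ZMod p) 2}
    (hdet : ∀ σ : Field.absoluteGaloisGroup ℚ, Matrix.GeneralLinearGroup.det (ρ σ) = modPCyclotomicCharacterZMod ℚ p σ)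
    (habs : FramedRep.IsAbsolutelyIrreducible ρ) (j : ZMod p →+* k) {a a' : ℕ}
    (hKr : ∀ (loc : LocalRestrictionAt p (FramedRep.baseChange j continuous_of_discreteTopology ρ))
      (ι : absIntegers 𝒪[loc.F] loc.F ⧸ absMaximalIdeal loc.F →+* k),
      loc.rep.HasLevelOneInertiaShape ι ((p : ℕ) : 𝒪[loc.F]) loc.irreducible_natCast a a')
    {s β α : ℕ} (hβ : a + s ≡ β [MOD p - 1]) (hα : a' + s ≡ α [MOD p - 1])
    (hα1 : 1 ≤ α) (hαp : α + 2 ≤ p) (hβ1 : 1 ≤ β) (hβp : β + 2 ≤ p) (hne : β ≠ α + 1) (hne' : α ≠ β + 1)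
    {N : ℕ} [NeZero N] (hpN : ¬ p ∣ N) {w : ℤ} (hw2 : 2 ≤ w) (hwp : w ≤ p)
    (f : CuspForm (Gamma1 N) w) (ιf : coeffCharIntegers f →+* k) (hf : IsNewform1 f)
    (hgal : IsGaloisRepOfNewform1Int f ιf {q | q ∣ N * p}
      (FramedRep.twist (FramedRep.baseChange j continuous_of_discreteTopology ρ) (modPCyclotomicCharacter ℚ k p j ^ s))) :
    False := by
  have hp : p.Prime := Fact.out
  -- irreducibility and oddness of the twist
  have hirrbc : (FramedRep.baseChange j continuous_of_discreteTopology ρ).toContinuousRep.IsIrreducible :=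
    habs.isIrreducible_baseChange k j _
  have hirr' : (FramedGaloisRep.toGaloisRep (K := ℚ)
      (FramedRep.twist (FramedRep.baseChange j continuous_of_discreteTopology ρ) (modPCyclotomicCharacter ℚ k p j ^ s) :
        ModPGaloisRep ℚ k 2)).IsIrreducible := by
    refine FramedRep.isIrreducible_of_twist (χ := modPCyclotomicCharacter ℚ k p j ^ s) (fun g => ?_) hirrbc
    rw [FramedRep.twist_apply]
    congr 1
  have hodd : FramedGaloisRep.IsOdd (FramedRep.baseChange j continuous_of_discreteTopology ρ) :=
    (ModPGaloisRep.isOdd_of_det_eq_modPCyclotomicCharacterZMod ρ hdet).baseChange j _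
  have hodd' : FramedGaloisRep.IsOdd
      (FramedRep.twist (FramedRep.baseChange j continuous_of_discreteTopology ρ) (modPCyclotomicCharacter ℚ k p j ^ s)) := by
    intro φ c hc
    rw [FramedRep.det_twist_apply, ← map_pow, hc.sq_eq_one, map_one, one_mul]
    exact hodd φ c hc
  -- local restriction datum, residue embedding, twisted datum
  obtain ⟨loc₀⟩ := nonempty_localRestrictionAt p (FramedRep.baseChange j continuous_of_discreteTopology ρ)
  obtain ⟨ι⟩ := nonempty_ringHom_residue (k := k) p loc₀.F loc₀.residueFieldCard_eq
  let loc' : LocalRestrictionAt p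
      (FramedRep.twist (FramedRep.baseChange j continuous_of_discreteTopology ρ) (modPCyclotomicCharacter ℚ k p j ^ s) :
        ModPGaloisRep ℚ k 2) :=
    { F := loc₀.F
      residueFieldCard_eq := loc₀.residueFieldCard_eq
      irreducible_natCast := loc₀.irreducible_natCast
      rep := FramedRep.twist loc₀.rep ((modPCyclotomicCharacter ℚ k p j ^ s).comp (absGaloisRestrict ℚ loc₀.F))
      rep_eq_restrictField := by rw [loc₀.rep_eq_restrictField, restrictField_twist] }
  -- Edixhoven: `k(ω^s ρ̄) ≤ w`
  have hdet' : ∃ σ ∈ absInertia loc'.F, Matrix.GeneralLinearGroup.det (loc'.rep σ) ≠ 1 :=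
    exists_det_twist_ne_one hp2 hdet j loc₀ s
  have hle := hEd p (hp.odd_of_ne_two hp2) k _ hirr' hodd' N hpN w hw2 f ιf hf hgal loc' ι hdet'
  -- the shape of the twist, normalised, and the unconditional evaluation of Serre's recipe
  have hsh := hasLevelOneInertiaShape_twist_pow loc₀ ι j (hKr loc₀ ι) s
  have hq : residueFieldCard loc₀.F - 1 = p - 1 := by rw [loc₀.residueFieldCard_eq]
  have hsh' : loc'.rep.HasLevelOneInertiaShape ι ((p : ℕ) : 𝒪[loc'.F]) loc'.irreducible_natCast β α :=
    hsh.of_modEq (by rw [hq]; exact hβ) (by rw [hq]; exact hα)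
  have hwt := serreWeight_eq_of_hasLevelOneInertiaShape_generic loc' ι hsh' hα1 hαp hβ1 hβp hne hne'
  have hge : p + 1 ≤ serreWeight p _ loc' ι := by
    rw [hwt]
    have h1 : 1 ≤ min α β := le_min hα1 hβ1
    have : p ≤ p * min α β := Nat.le_mul_of_pos_right p (by omega)
    omega
  omega

/-! ### (W‴) on types II and IV from the three facts -/

/-- **(W‴) on Kodaira type II from WEIGHT ∧ SHAPE ∧ MIN only.**  As `noEtaleWeightEigenQuotient_typeII_of_facts` without the two
Serre-recipe hypotheses: the normalised shapes `(r + 1, 2b + r)`, `r ∈ {0, 3b}`, lie in the generic range of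
`serreWeight_eq_of_hasLevelOneInertiaShape_generic`.
[cite: BuzzardDiamondJarvis2010, §2 Prop. 2.5, Cor. 2.10] [cite: Kraus1997Dissertationes, Prop. 1] [cite: Edixhoven1992, Thm. 4.5]
[cite: Serre1987, §2.2–2.4] -/
theorem noEtaleWeightEigenQuotient_typeII_of_three_facts
    (hWt : fullLevelHomology_twist_isModular_of_eigenMap)
    (hKr : Kraus1997.propOne_inertiaShape_of_ordinary)
    (hEd : edixhoven1992_serreWeight_le_weight_of_newform)
    (p M : ℕ) [Fact p.Prime] [NeZero M] (W : WeierstrassCurve ℚ) [W.IsElliptic] [W.IsGloballyMinimal]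
    (hN : W.conductorNorm ℤ = p ^ 2 * M) (hp11 : 11 ≤ p) (hadd : Rank1Residual.Addv W p) (hirr : Rank1Residual.Irr W p)
    (hGo : Summit.BirchSwinnertonDyer.Rank1Residual.Additive.TypeGOrd W p) (hV4 : padicValInt p W.minimalDiscriminantInt ≤ 4)
    (hII : padicValInt p W.minimalDiscriminantInt = 2) :
    letI : Algebra ℤ_[p] (ZMod p) := (PadicInt.toZMod (p := p)).toAlgebra
    ∀ Θ : H1carrier ℤ_[p] p M →ₗ[ℤ_[p]] ↥(MvPolynomial.homogeneousSubmodule (Fin 2) (ZMod p) (2 * tameExponent p W)),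
    (∀ (g : GL (Fin 2) (ZMod p)) (z : H1carrier ℤ_[p] p M),
        Θ (H1carrierRep ℤ_[p] p M g z) =
          symPowTwist (ZMod.castHom (dvd_refl p) (ZMod p))
            (reduceChar (ZMod p) (Kato2004.teichmullerChar p ^ (p - 1 - tameExponent p W)))
            (2 * tameExponent p W) g (Θ z)) →
    (∀ (q : ℕ) [NeZero q] (hq : q.Prime) (hqp : q ≠ p) (z : H1carrier ℤ_[p] p M),
        Θ (heckeT ℤ_[p] p M hq hqp z) = (((W.LFunction q : ℤ) : ZMod p)) • Θ z) →
    Θ = 0 := by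
  intro Θ hΘG hΘT
  by_contra hΘ0
  have hp : p.Prime := Fact.out
  have hp5 : 5 ≤ p := le_trans (by norm_num) hp11
  have hp2 : p ≠ 2 := by omega
  -- type II arithmetic: `6 b = p - 1`, `2 ≤ b`
  have h6b : 6 * tameExponent p W = p - 1 := by
    rcases TameExponent.tameExponent_cases W p hp5 hadd hGo hV4 with ⟨_, _, h⟩ | ⟨h3, _, _⟩ | ⟨h4, _, _⟩
    · exact h
    · omega
    · omega
  have hb2 : 2 ≤ tameExponent p W := TameExponent.two_le_tameExponent W p hp11 hadd hGo hV4
  have hpM : Nat.Coprime p M := coprime_of_conductorNorm_eq_sq_mul W p M hp5 hN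
  haveI : NeZero ((p : ℕ) : ℚ) := ⟨by exact_mod_cast hp.ne_zero⟩
  obtain ⟨ρ, hρ⟩ := W.exists_isTorsionGaloisRep p
  letI : TopologicalSpace (AlgebraicClosure (ZMod p)) := ⊥
  haveI : DiscreteTopology (AlgebraicClosure (ZMod p)) := ⟨rfl⟩
  obtain ⟨s, N, hN0, f, ιf, hsdiv, hpN, hf, hgal⟩ :=
    hWt p M W (2 * tameExponent p W) (p - 1 - tameExponent p W) hp5 hpM (by omega) ⟨2, by omega⟩ hirr
      ⟨Θ, hΘ0, hΘG, hΘT⟩ ρ hρ (AlgebraicClosure (ZMod p)) (algebraMap (ZMod p) (AlgebraicClosure (ZMod p)))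
  haveI := hN0
  have hPGO : W.HasPotentiallyGoodOrdinaryReductionAtPrime p :=
    W.hasPotentiallyGoodOrdinaryReductionAtPrime_of_forall_intermediateField p hp hGo
  have hKr' : ∀ (loc : LocalRestrictionAt p (FramedRep.baseChange (algebraMap (ZMod p) (AlgebraicClosure (ZMod p)))
      continuous_of_discreteTopology ρ)) (ι : absIntegers 𝒪[loc.F] loc.F ⧸ absMaximalIdeal loc.F →+* AlgebraicClosure (ZMod p)),
      loc.rep.HasLevelOneInertiaShape ι ((p : ℕ) : 𝒪[loc.F]) loc.irreducible_natCast (p - tameExponent p W) (tameExponent p W) :=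
    fun loc ι => hKr p hp5 W hadd hPGO ρ hρ (AlgebraicClosure (ZMod p)) _ continuous_of_discreteTopology loc ι
  -- `r = (s + 5b) mod 6b ∈ {0, 3b}`
  have h5b : p - 1 - tameExponent p W = 5 * tameExponent p W := by omega
  obtain ⟨c, hc⟩ := hsdiv
  rw [h5b, ← h6b] at hc
  have hx : s + 5 * tameExponent p W = 3 * tameExponent p W * c := Nat.eq_of_mul_eq_mul_left two_pos (by rw [hc]; ring)
  obtain ⟨hmod, hrle⟩ := mod_six_mul_of_eq_three_mul (tameExponent p W) c (s + 5 * tameExponent p W) hx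
  generalize hr : 3 * tameExponent p W * (c % 2) = r at hmod hrle
  have hsr : s + 5 * tameExponent p W ≡ r [MOD p - 1] := by
    unfold Nat.ModEq
    rw [← h6b, hmod, Nat.mod_eq_of_lt (by omega)]
  have hβ : p - tameExponent p W + s ≡ r + 1 [MOD p - 1] := by
    rw [show p - tameExponent p W + s = s + 5 * tameExponent p W + 1 by omega]
    exact hsr.add_right 1
  have hα : tameExponent p W + s ≡ 2 * tameExponent p W + r [MOD p - 1] := by
    refine Nat.ModEq.add_right_cancel' (4 * tameExponent p W) ?_
    rw [show tameExponent p W + s + 4 * tameExponent p W = s + 5 * tameExponent p W by omega,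
      show 2 * tameExponent p W + r + 4 * tameExponent p W = r + (p - 1) by omega]
    exact hsr.trans Nat.add_modEq_right.symm
  exact false_of_twist_isModular_of_generic_shape hp2 hEd (W.det_eq_modPCyclotomicCharacter_of_isTorsionGaloisRep_holds p ρ hρ)
    (BCDT.isAbsolutelyIrreducible_of_hasIrreducibleModPGaloisRep W hp2 hirr hρ) _ hKr' hβ hα
    (by omega) (by omega) (by omega) (by omega) (by omega) (by omega) hpN (w := ((2 * tameExponent p W : ℕ) : ℤ) + 2)
    (by omega) (by push_cast; omega) f ιf hf hgal

/-- **(W‴) on Kodaira type IV from WEIGHT ∧ SHAPE ∧ MIN only.**  As `noEtaleWeightEigenQuotient_typeIV_of_facts` without the two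
Serre-recipe hypotheses: the normalised shapes `(1, 2b)` and `(3h + 1, h)` (`b = 2h`) lie in the generic range.
[cite: BuzzardDiamondJarvis2010, §2 Prop. 2.5, Cor. 2.10] [cite: Kraus1997Dissertationes, Prop. 1] [cite: Edixhoven1992, Thm. 4.5]
[cite: Serre1987, §2.2–2.4] -/
theorem noEtaleWeightEigenQuotient_typeIV_of_three_facts
    (hWt : fullLevelHomology_twist_isModular_of_eigenMap)
    (hKr : Kraus1997.propOne_inertiaShape_of_ordinary)
    (hEd : edixhoven1992_serreWeight_le_weight_of_newform)
    (p M : ℕ) [Fact p.Prime] [NeZero M] (W : WeierstrassCurve ℚ) [W.IsElliptic] [W.IsGloballyMinimal]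
    (hN : W.conductorNorm ℤ = p ^ 2 * M) (hp11 : 11 ≤ p) (hadd : Rank1Residual.Addv W p) (hirr : Rank1Residual.Irr W p)
    (hGo : Summit.BirchSwinnertonDyer.Rank1Residual.Additive.TypeGOrd W p) (hV4 : padicValInt p W.minimalDiscriminantInt ≤ 4)
    (hIV : padicValInt p W.minimalDiscriminantInt = 4) :
    letI : Algebra ℤ_[p] (ZMod p) := (PadicInt.toZMod (p := p)).toAlgebra
    ∀ Θ : H1carrier ℤ_[p] p M →ₗ[ℤ_[p]] ↥(MvPolynomial.homogeneousSubmodule (Fin 2) (ZMod p) (2 * tameExponent p W)),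
    (∀ (g : GL (Fin 2) (ZMod p)) (z : H1carrier ℤ_[p] p M),
        Θ (H1carrierRep ℤ_[p] p M g z) =
          symPowTwist (ZMod.castHom (dvd_refl p) (ZMod p))
            (reduceChar (ZMod p) (Kato2004.teichmullerChar p ^ (p - 1 - tameExponent p W)))
            (2 * tameExponent p W) g (Θ z)) →
    (∀ (q : ℕ) [NeZero q] (hq : q.Prime) (hqp : q ≠ p) (z : H1carrier ℤ_[p] p M),
        Θ (heckeT ℤ_[p] p M hq hqp z) = (((W.LFunction q : ℤ) : ZMod p)) • Θ z) →
    Θ = 0 := by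
  intro Θ hΘG hΘT
  by_contra hΘ0
  have hp : p.Prime := Fact.out
  have hp5 : 5 ≤ p := le_trans (by norm_num) hp11
  have hp2 : p ≠ 2 := by omega
  have h3b : 3 * tameExponent p W = p - 1 := by
    rcases TameExponent.tameExponent_cases W p hp5 hadd hGo hV4 with ⟨h2, _, _⟩ | ⟨h3, _, _⟩ | ⟨_, _, h⟩
    · omega
    · omega
    · exact h
  have h13 := TameExponent.thirteen_le W p hp11 hadd hGo hV4
  obtain ⟨m, hm⟩ := hp.eq_two_or_odd'.resolve_left hp2
  obtain ⟨h, hbh⟩ : ∃ h : ℕ, tameExponent p W = 2 * h := ⟨tameExponent p W / 2, by omega⟩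
  have h6h : 6 * h = p - 1 := by omega
  have hh2 : 2 ≤ h := by omega
  have hpM : Nat.Coprime p M := coprime_of_conductorNorm_eq_sq_mul W p M hp5 hN
  haveI : NeZero ((p : ℕ) : ℚ) := ⟨by exact_mod_cast hp.ne_zero⟩
  obtain ⟨ρ, hρ⟩ := W.exists_isTorsionGaloisRep p
  letI : TopologicalSpace (AlgebraicClosure (ZMod p)) := ⊥
  haveI : DiscreteTopology (AlgebraicClosure (ZMod p)) := ⟨rfl⟩
  obtain ⟨s, N, hN0, f, ιf, hsdiv, hpN, hf, hgal⟩ :=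
    hWt p M W (2 * tameExponent p W) (p - 1 - tameExponent p W) hp5 hpM (by omega) ⟨2, by omega⟩ hirr
      ⟨Θ, hΘ0, hΘG, hΘT⟩ ρ hρ (AlgebraicClosure (ZMod p)) (algebraMap (ZMod p) (AlgebraicClosure (ZMod p)))
  haveI := hN0
  have hPGO : W.HasPotentiallyGoodOrdinaryReductionAtPrime p :=
    W.hasPotentiallyGoodOrdinaryReductionAtPrime_of_forall_intermediateField p hp hGo
  have hKr' : ∀ (loc : LocalRestrictionAt p (FramedRep.baseChange (algebraMap (ZMod p) (AlgebraicClosure (ZMod p)))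
      continuous_of_discreteTopology ρ)) (ι : absIntegers 𝒪[loc.F] loc.F ⧸ absMaximalIdeal loc.F →+* AlgebraicClosure (ZMod p)),
      loc.rep.HasLevelOneInertiaShape ι ((p : ℕ) : 𝒪[loc.F]) loc.irreducible_natCast (p - tameExponent p W) (tameExponent p W) :=
    fun loc ι => hKr p hp5 W hadd hPGO ρ hρ (AlgebraicClosure (ZMod p)) _ continuous_of_discreteTopology loc ι
  obtain ⟨c, hc⟩ := hsdiv
  have hx : s + 4 * h = 3 * h * c := by
    rw [show p - 1 - tameExponent p W = 4 * h by omega, ← h6h] at hc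
    exact Nat.eq_of_mul_eq_mul_left two_pos (by rw [hc]; ring)
  have hw2 : (2 : ℤ) ≤ ((2 * tameExponent p W : ℕ) : ℤ) + 2 := by omega
  have hwp : ((2 * tameExponent p W : ℕ) : ℤ) + 2 ≤ p := by push_cast; omega
  rcases Nat.mod_two_eq_zero_or_one c with hc0 | hc1
  · obtain ⟨hβ, hα⟩ := typeIV_shape_even h6h hbh (by omega) hx hc0
    exact false_of_twist_isModular_of_generic_shape hp2 hEd (W.det_eq_modPCyclotomicCharacter_of_isTorsionGaloisRep_holds p ρ hρ)
      (BCDT.isAbsolutelyIrreducible_of_hasIrreducibleModPGaloisRep W hp2 hirr hρ) _ hKr' hβ hα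
      (by omega) (by omega) le_rfl (by omega) (by omega) (by omega) hpN hw2 hwp f ιf hf hgal
  · obtain ⟨hβ, hα⟩ := typeIV_shape_odd h6h hbh (by omega) hx hc1
    exact false_of_twist_isModular_of_generic_shape hp2 hEd (W.det_eq_modPCyclotomicCharacter_of_isTorsionGaloisRep_holds p ρ hρ)
      (BCDT.isAbsolutelyIrreducible_of_hasIrreducibleModPGaloisRep W hp2 hirr hρ) _ hKr' hβ hα
      (by omega) (by omega) (by omega) (by omega) (by omega) (by omega) hpN hw2 hwp f ιf hf hgal

/-- **(W‴) `NoEtaleWeightEigenQuotient` on `ord_pΔ_min ≠ 3` (Kodaira types II and IV) from WEIGHT ∧ SHAPE ∧ MIN only** — the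
strongest form landed by this seat: the route-posited weight exclusion of the K-line follows, off Kodaira type III, from three
cite-only published facts (Buzzard–Diamond–Jarvis 2010 §2 + Ash–Stevens; Kraus 1997 Prop. 1; Edixhoven 1992 Thm. 4.5), Serre's
recipe being evaluated unconditionally.
[cite: BuzzardDiamondJarvis2010, §2 Prop. 2.5, Cor. 2.10] [cite: Kraus1997Dissertationes, Prop. 1] [cite: Edixhoven1992, Thm. 4.5]
[cite: Serre1987, §2.2–2.4] -/
theorem noEtaleWeightEigenQuotient_of_ne_three_of_three_facts
    (hWt : fullLevelHomology_twist_isModular_of_eigenMap)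
    (hKr : Kraus1997.propOne_inertiaShape_of_ordinary)
    (hEd : edixhoven1992_serreWeight_le_weight_of_newform)
    (p M : ℕ) [Fact p.Prime] [NeZero M] (W : WeierstrassCurve ℚ) [W.IsElliptic] [W.IsGloballyMinimal]
    (hN : W.conductorNorm ℤ = p ^ 2 * M) (hp11 : 11 ≤ p) (hadd : Rank1Residual.Addv W p) (hirr : Rank1Residual.Irr W p)
    (hGo : Summit.BirchSwinnertonDyer.Rank1Residual.Additive.TypeGOrd W p) (hV4 : padicValInt p W.minimalDiscriminantInt ≤ 4)
    (hIII : padicValInt p W.minimalDiscriminantInt ≠ 3) :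
    letI : Algebra ℤ_[p] (ZMod p) := (PadicInt.toZMod (p := p)).toAlgebra
    ∀ Θ : H1carrier ℤ_[p] p M →ₗ[ℤ_[p]] ↥(MvPolynomial.homogeneousSubmodule (Fin 2) (ZMod p) (2 * tameExponent p W)),
    (∀ (g : GL (Fin 2) (ZMod p)) (z : H1carrier ℤ_[p] p M),
        Θ (H1carrierRep ℤ_[p] p M g z) =
          symPowTwist (ZMod.castHom (dvd_refl p) (ZMod p))
            (reduceChar (ZMod p) (Kato2004.teichmullerChar p ^ (p - 1 - tameExponent p W)))
            (2 * tameExponent p W) g (Θ z)) →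
    (∀ (q : ℕ) [NeZero q] (hq : q.Prime) (hqp : q ≠ p) (z : H1carrier ℤ_[p] p M),
        Θ (heckeT ℤ_[p] p M hq hqp z) = (((W.LFunction q : ℤ) : ZMod p)) • Θ z) →
    Θ = 0 := by
  intro Θ hΘG hΘT
  have hp5 : 5 ≤ p := le_trans (by norm_num) hp11
  rcases TameExponent.padicValInt_mem W p hp5 hadd hV4 with h2 | h3 | h4
  · exact noEtaleWeightEigenQuotient_typeII_of_three_facts hWt hKr hEd p M W hN hp11 hadd hirr hGo hV4 h2 Θ hΘG hΘT
  · exact absurd h3 hIII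
  · exact noEtaleWeightEigenQuotient_typeIV_of_three_facts hWt hKr hEd p M W hN hp11 hadd hirr hGo hV4 h4 Θ hΘG hΘT

end WeightExclusion

end Summit.BirchSwinnertonDyer.BirchSwinnertonDyer.Theorems.TeichmullerTwistDescent
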